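import Mathlib.Data.Real.Basic
import Mathlib.Algebra.Ring.GrindInstances
import HarnessLib

/-!
# Four-point certificate kernel (syntactic layer): rows as mask syntax over the 15 connectivity patterns of `(a,b,c,y)`,
# compiled to `Lean.Grind.CommRing.Expr`, identity checked by the kernel through `Expr.toPoly_k` (proof by reflection).

Support file (prover prim-l12-p2, `--supports stmt-CriticalPhenomena-4575`): the SYNTACTIC half of a kernel-checked certificate checker
for polynomial inequalities on the 15-cell four-point law (used to replay prim-facecert's exact degree-5 certificate of (L1); data in
`…L1CertData*`, check in `…L1Cert`, semantics in `…L1CertSemantics`).  No sorries, no named facts, no `native_decide`.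

Cell order (facecert / bern4): 0 `a|b|c|y`, 1 `a|b|cy`, 2 `a|by|c`, 3 `a|bc|y`, 4 `ay|b|c`, 5 `ac|b|y`, 6 `ab|c|y`, 7 `a|bcy`, 8 `ay|bc`, 9 `ac|by`,
10 `acy|b`, 11 `ab|cy`, 12 `aby|c`, 13 `abc|y`, 14 `abcy`.  A MASK is a natural number `< 2^15` (bit `i` = cell `i`).
Labels `0=a, 1=b, 2=c, 3=y`; PAIRS `0=ab, 1=ac, 2=ay, 3=bc, 4=by, 5=cy`.
-/

namespace Summit.CriticalPhenomena.PercolationContinuityZ3.Theorems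

namespace FourPointCert

open Lean.Grind.CommRing

/-! ### Tables -/

/-- `joinedTab[π]` = 6-bit mask of the pairs joined in partition `π`. [this work] -/
def joinedTab : List Nat := [0, 32, 16, 8, 4, 2, 1, 56, 12, 18, 38, 33, 21, 11, 63]

/-- Pairs joined in partition `π`. [this work] -/
def joined (π k : Nat) : Bool := (joinedTab.getD π 0).testBit k

/-- The partition obtained from `π` by gluing `a` and `y`. [this work] -/
def mergeTab : List Nat := [4, 10, 12, 8, 4, 10, 12, 14, 8, 14, 10, 14, 12, 14, 14]

/-- Glue `a ~ y`. [this work] -/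
def mergeAY (π : Nat) : Nat := mergeTab.getD π 0

/-- The full mask (all 15 cells). [this work] -/
def full : Nat := 2 ^ 15 - 1

/-- Cells (as a mask) satisfying a decidable predicate. [this work] -/
def maskOf (P : Nat → Bool) : Nat := go 0 15 0
where
  /-- accumulate over cells `i, i+1, …` -/
  go : Nat → Nat → Nat → Nat
  | _, 0, acc => acc
  | i, fuel + 1, acc => go (i + 1) fuel (if P i then acc ||| (2 ^ i) else acc)

/-- Pair index of two distinct labels (`0=a,1=b,2=c,3=y`). [this work] -/
def pairIdx (u v : Nat) : Nat :=
  let u' := min u v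
  let v' := max u v
  if u' = 0 then v' - 1 else if u' = 1 then v' + 1 else 5

/-- Are labels `u, v` joined in partition `π` (reflexive)? [this work] -/
def jn (π u v : Nat) : Bool := if u = v then true else joined π (pairIdx u v)

/-- The connection event `{u ~ v}` as a mask. [this work] -/
def connMask (u v : Nat) : Nat := maskOf fun π => jn π u v

/-- Group separation `D[X|Y]` (no cluster meets both label sets, given as 4-bit masks) as a 15-bit mask. [this work] -/
def gsepMask (X Y : Nat) : Nat :=
  maskOf fun π => (List.range 4).all fun u => (List.range 4).all fun v =>
    !(X.testBit u && Y.testBit v) || !(jn π u v)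

/-- Preimage of a mask under the gluing `a ~ y`: cells `π` with `mergeAY π ∈ T`. [this work] -/
def preGlue (T : Nat) : Nat := maskOf fun π => T.testBit (mergeAY π)

/-- The five three-point cells `(q, u_xz, u_xw, u_zw, t)` of the triple `(x,z,w)` as masks, optionally of the `a~y`-glued law. [this work] -/
def law3 (x z w : Nat) (glued : Bool) : Nat × Nat × Nat × Nat × Nat :=
  let g := fun (m : Nat) => if glued then preGlue m else m
  let sm := fun (π p r : Nat) => jn π p r
  let q := maskOf fun π => !sm π x z && !sm π x w && !sm π z w
  let uxz := maskOf fun π => sm π x z && !sm π x w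
  let uxw := maskOf fun π => sm π x w && !sm π x z
  let uzw := maskOf fun π => sm π z w && !sm π x z
  let t := maskOf fun π => sm π x z && sm π x w
  (g q, g uxz, g uxw, g uzw, g t)

/-! ### Row syntax -/

/-- A certificate row.  `harris E F`: `σ·m(E∩F) − m(E)m(F)` (valid for up-closed masks); `sunflower A petals glued`: Gladkov's
`m(A)m(B) − e₂(m(Cᵢ))`, `B` the complement (valid when `A`, `A ∪ Cᵢ` up-closed, cells disjoint; on the glued law if `glued`);
`shk x z w glued`: SHK3⁺ `(σ+t)(qt−e₂(u))−e₃(u)` of the triple; `hyb c P₁ P₃ P₃'`: hybrid three-point lower bound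
`E₃({P₁≁c},{c≁P₃},{P₁≁P₃'})` (`P₃ ⊆ P₃'`, label sets as 4-bit masks); `cell i`: the cell itself. [this work] -/
inductive RowSpec where
  | cell (i : Nat)
  | harris (E F : Nat)
  | sunflower (A : Nat) (petals : List Nat) (glued : Bool)
  | shk (x z w : Nat) (glued : Bool)
  | hyb (c P₁ P₃ P₃' : Nat)
  deriving Repr, DecidableEq, Inhabited

/-- A row together with its multiplier: a list of `(coefficient, cell monomial as a list of cell indices, power of the region factor
`x₂ − x₁`)`. [this work] -/
structure RowBlock where
  /-- the row -/
  row : RowSpec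
  /-- multiplier terms `(c, mono, regPow)` meaning `c · ∏ mono · (x₂ − x₁)^regPow` -/
  mult : List (Nat × List Nat × Nat)
  deriving Repr, Inhabited

/-! ### Compilation to `Lean.Grind.CommRing.Expr` -/

/-- Sum of the cell variables in a mask. [this work] -/
def maskE (m : Nat) : Expr := go 0 15 (.natCast 0)
where
  /-- accumulate -/
  go : Nat → Nat → Expr → Expr
  | _, 0, acc => acc
  | i, fuel + 1, acc => go (i + 1) fuel (if m.testBit i then .add acc (.var i) else acc)

/-- `σ` = sum of all cells. [this work] -/
def sigmaE : Expr := maskE full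

/-- `e₂` of a list of expressions. [this work] -/
def e2E : List Expr → Expr
  | [] => .natCast 0
  | a :: l => .add (.mul a (l.foldr (fun b acc => .add b acc) (.natCast 0))) (e2E l)

/-- Union of a list of masks. [this work] -/
def unionMasks (l : List Nat) : Nat := l.foldr (fun m acc => m ||| acc) 0

/-- The homogenised Richards–Sahi cubic `2σ²m(ABC) + m(A)m(B)m(C) − σ(m(A)m(BC) + m(B)m(AC) + m(C)m(AB))`. [this work] -/
def e3E (A B C : Nat) : Expr :=
  .sub (.add (.mul (.mul (.mul (.natCast 2) sigmaE) sigmaE) (maskE (A &&& B &&& C))) (.mul (.mul (maskE A) (maskE B)) (maskE C)))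
    (.mul sigmaE (.add (.add (.mul (maskE A) (maskE (B &&& C))) (.mul (maskE B) (maskE (A &&& C)))) (.mul (maskE C) (maskE (A &&& B)))))

/-- The row polynomial as an `Expr`. [this work] -/
def rowE : RowSpec → Expr
  | .cell i => .var i
  | .harris E F => .sub (.mul sigmaE (maskE (E &&& F))) (.mul (maskE E) (maskE F))
  | .sunflower A petals glued =>
    let g := fun (m : Nat) => if glued then preGlue m else m
    let B := full ^^^ (A ||| unionMasks petals)
    .sub (.mul (maskE (g A)) (maskE (g B))) (e2E (petals.map fun p => maskE (g p)))
  | .shk x z w glued =>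
    let (q, u₁, u₂, u₃, t) := law3 x z w glued
    .sub (.mul (.add sigmaE (maskE t)) (.sub (.mul (maskE q) (maskE t)) (e2E [maskE u₁, maskE u₂, maskE u₃])))
      (.mul (.mul (maskE u₁) (maskE u₂)) (maskE u₃))
  | .hyb c P₁ P₃ P₃' => e3E (gsepMask (2 ^ c) P₁) (gsepMask (2 ^ c) P₃) (gsepMask P₁ P₃')

/-- Product of cell variables. [this work] -/
def monoE : List Nat → Expr
  | [] => .natCast 1
  | i :: l => .mul (.var i) (monoE l)

/-- The region factor `x₂ − x₁` (`«a|by|c» − «a|b|cy»`). [this work] -/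
def regE : Expr := .sub (.var 2) (.var 1)

/-- `(x₂ − x₁)^r · e`. [this work] -/
def regPowE : Nat → Expr → Expr
  | 0, e => e
  | r + 1, e => .mul regE (regPowE r e)

/-- One multiplier term `c · mono · (x₂−x₁)^r`. [this work] -/
def multTermE (t : Nat × List Nat × Nat) : Expr :=
  regPowE t.2.2 (.mul (.natCast t.1) (monoE t.2.1))

/-- Pair up adjacent summands. [this work] -/
def pairUp : List Expr → List Expr
  | [] => []
  | [a] => [a]
  | a :: b :: rest => .add a b :: pairUp rest

/-- Balanced sum of a list of expressions (`fuel` halvings, then a left fold). [this work] -/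
def sumBal : Nat → List Expr → Expr
  | 0, l => l.foldl (fun acc b => .add acc b) (.natCast 0)
  | _ + 1, [] => .natCast 0
  | _ + 1, [a] => a
  | fuel + 1, a :: b :: l => sumBal fuel (pairUp (a :: b :: l))

/-- The terms `(c · mono · (x₂−x₁)^r) · row` of one block. [this work] -/
def blockTermsE (b : RowBlock) : List Expr := b.mult.map fun t => .mul (multTermE t) (rowE b.row)

/-- All terms of the certificate. [this work] -/
def certTermsE : List RowBlock → List Expr
  | [] => []
  | b :: bs => blockTermsE b ++ certTermsE bs

/-- The whole right-hand side `Σ_blocks Σ_terms (c · mono · (x₂−x₁)^r) · row`, summed as a balanced tree. [this work] -/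
def certE (bs : List RowBlock) : Expr := sumBal 20 (certTermsE bs)

/-- The multiplier `M = Σ c · mono` (a list of `(c, mono)`). [this work] -/
def polyE (ms : List (Nat × List Nat)) : Expr := sumBal 16 (ms.map fun t => .mul (.natCast t.1) (monoE t.2))

/-- The target `(L1)` homogenised: `E₃(D_bc,D_ac,G_ab) + E₃(D_bc,G_ac,D_ab) − σ·β·m(D_bc)`, `β` = cell 7 `a|bcy`. [this work] -/
def l1E : Expr :=
  .sub (.add (e3E (gsepMask 2 4) (gsepMask 1 4) (gsepMask 9 2)) (e3E (gsepMask 2 4) (gsepMask 9 4) (gsepMask 1 2)))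
    (.mul (.mul sigmaE (.var 7)) (maskE (gsepMask 2 4)))

/-- The kernel check of `lhs = Σ mult·row` for an arbitrary target expression: the difference normalises to the zero polynomial
(`Expr.toPoly_k`, evaluated by the kernel). [this work] -/
noncomputable def checkEq (lhs : Expr) (bs : List RowBlock) : Bool :=
  Stepwise.imp_1eq_cert lhs (certE bs) (.num 0) (.num 0)

/-- Soundness of `checkEq`: the identity holds in every commutative ring. [this work] -/
theorem denote_eq_of_checkEq {α : Type} [Lean.Grind.CommRing α] (ctx : Context α) {lhs : Expr} {bs : List RowBlock}
    (h : checkEq lhs bs = true) : lhs.denote ctx = (certE bs).denote ctx :=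
  Stepwise.imp_1eq ctx _ _ (.num 0) (.num 0) h (Stepwise.d_init ctx (.num 0))

/-- The kernel check for the target (L1): `M · L1 − Σ mult·row` normalises to the zero polynomial. [this work] -/
noncomputable def check (M : List (Nat × List Nat)) (bs : List RowBlock) : Bool :=
  checkEq (.mul (polyE M) l1E) bs

/-- Soundness of the kernel check: `M · L1 = Σ mult·row` in every commutative ring. [this work] -/
theorem denote_eq_of_check {α : Type} [Lean.Grind.CommRing α] (ctx : Context α) {M : List (Nat × List Nat)} {bs : List RowBlock}
    (h : check M bs = true) : (Expr.mul (polyE M) l1E).denote ctx = (certE bs).denote ctx :=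
  denote_eq_of_checkEq ctx h

end FourPointCert

end Summit.CriticalPhenomena.PercolationContinuityZ3.Theorems
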